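import Literature.NumberTheory.EllipticCurves.KatoRankBoundAllPrimesSkeletonProofs
import Literature.NumberTheory.EllipticCurves.IwasawaAlgebraCharIdealProofs
import HarnessLib

/-!
# Kato's §17.13 skeleton at an EXCEPTIONAL-ZERO prime: the Coleman map into an ideal `J` and the
# `𝐇²_loc` error term of Thm. 12.5 (3) cancel — `J · char_Λ X ∣ p^m L`

K. Kato, *`p`-adic Hodge theory and values of zeta functions of modular forms*, Astérisque **295**
(2004) [Kato2004Asterisque], proves Thm. 17.4 in §17.13 (pp. 279–280) by module theory from the
Poitou–Tate sequence (17.13.1)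
`0 → 𝐇¹(T(k))/lim H¹_f → 𝐇¹_loc(T(k))/lim H¹_f → 𝔛(T*(1-k)) → 𝐇²(T(k)) → 𝐇²_loc(T(k))`
("exact if `p ≠ 2`, and is exact upto `×2` in the case `p = 2`", p. 279), Thm. 12.4, Prop. 17.11
with Thm. 16.6, and the Euler-system bound Thm. 12.5 (3) (p. 222):

> "(3) Let `𝔭` be a prime ideal of `Λ` of height one which does not contain `p`. Then
> `length_{Λ_𝔭}(𝐇²(V_{F_λ}(f))_𝔭) ≤ length_{Λ_𝔭}(𝐇¹(V_{F_λ}(f))_𝔭/Z(f)_𝔭) + length_{Λ_𝔭}(𝐇²_loc(V_{F_λ}(f))_𝔭)`.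
> If `𝐇²_loc(V_{F_λ}(f))_𝔭 ≠ 0`, then `f` and `𝔭` satisfy the following (12.5.1). (12.5.1) `k = 2`,
> `f` is not potentially of good reduction at `p` (12.7), `𝔭` is the kernel of the ring homomorphism
> `Λ → F_λ` induced by `κ^{·}χ` for some homomorphism `χ : G_∞ → F_λ^×` of finite order, and
> `length_{Λ_𝔭}(𝐇²_loc(V_{F_λ}(f))_𝔭) = 1`."

The tree proves the module theory of §17.13 for an ARBITRARY power series `L` with the
`𝐇²_loc`-term required to VANISH at the height-one primes `𝔭 ∌ p`
(`Kato2004.exists_mem_charIdeal_of_skeleton_upTo`, file `KatoRankBoundAllPrimesSkeletonProofs`;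
at a good or a NON-SPLIT multiplicative prime (12.5.1) fails and the term vanishes). At a SPLIT
multiplicative prime ("`E ⊗ ℚ_p` is a Tate curve", Remark 18.3, p. 281) the term is present at the
exceptional prime `𝔭₀`, and the Coleman map of the singular quotient no longer surjects onto a
finite-index submodule of `Λ` but lands in the augmentation ideal `I = 𝔭₀`: in print at odd `p`,
C. Wuthrich, *On the integrality of modular symbols and Kato's Euler system for elliptic curves*,
Doc. Math. **19** (2014) [Wuthrich2014], p. 391: "in the case when `E` has split multiplicative
reduction, then Theorem 4.1 in [Kobayashi 2006] proves that the Coleman map … is injective and has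
image with finite index inside `I = ker(𝟙 : Λ → ℤ_p)`", whence Cor. 19 (p. 398): "`I · char_Λ X(E)`
in the split multiplicative case, divides the ideal generated by `L_p(E)`" (S. Kobayashi, *An
elementary proof of the Mazur–Tate–Teitelbaum conjecture for elliptic curves*, Doc. Math. Extra
Vol. Coates (2006), Thm. 4.1 [Kobayashi2006DocMath]).

This file PROVES the corresponding module theory, over any domain and then over `Λ = ℤ_p⟦T⟧`, with
ALL cohomological inputs as explicit hypotheses on abstract modules (exactly as its siblings
`KatoDivisibilitySkeletonProofs`, `KatoRankBoundAllPrimesSkeletonProofs`; no definition, no named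
fact, D-0026): the two exceptional-zero phenomena CANCEL — the extra `+ length(𝐇²_loc)_𝔭₀` of
Thm. 12.5 (3) is matched by the surjectivity (up to a finite/`p`-power-torsion cokernel) of
`𝐇² → 𝐇²_loc` in the five-term sequence (17.13.1), and the Coleman map landing in `J` improves the
bookkeeping `length(P/loc Z)_𝔭 ≤ length(Λ/(G))_𝔭` by `length(Λ/J)_𝔭`.

* `Kato2004.lengthAt_range_add_le_of_upTo` — for `X →δ H2 →ε H2loc` with `c · ε(δ X) = 0` and
  `c · H2loc ⊆ ε(H2)`, `c ∉ 𝔭`: `length(δ X)_𝔭 + length(H2loc)_𝔭 ≤ length(H2)_𝔭`.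
* `Kato2004.lengthAt_quotient_range_add_le_of_range_le` — the bookkeeping of p. 280 with the
  Coleman map valued in an ideal `J`: `length(P/loc H)_𝔭 + length(H/Z)_𝔭 + length(R/J)_𝔭 ≤
  length(R/(G))_𝔭` (`loc`, `col` injective, `col(P) ⊆ J`, `G ∈ col(loc Z)`).
* `Kato2004.lengthAt_add_le_of_skeleton_exceptional` — Thm. 17.4 (2)-shape at one prime `𝔭 ∌ c`:
  `length X_𝔭 + length(R/J)_𝔭 ≤ length(R/(G))_𝔭`, from `H` torsion free of rank `≤ 1` (12.4 (2)),
  the maps `H → P → X → H2 → H2loc` exact up to `×c` at `P`, `X` and a complex up to `×c` at `H2`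
  with `c`-torsion cokernel at `H2loc` ((17.13.1), 14.9), `col : P ↪ J` (Kobayashi 4.1 shape),
  `G ∈ col(loc Z)` (16.6) and the PRINTED shape of 12.5 (3) WITH its `𝐇²_loc`-term.
* `Kato2004.exists_X_mul_mem_charIdeal_of_skeleton_exceptional` — over `Λ = ℤ_p⟦T⟧` with
  `J = (T)` and `ι G = p^n · L`, `L(0) = 0`: `X` is torsion and `ι(T·g) = p^m · L` for some
  `g ∈ char_Λ X` — the shape of the tree's typed target `X5.O1.KatoDivisibilityAtTwoSplitMultRat`
  (`T · char_Λ X ∣ L` in `Λ[1/p]`), uniformly in `p` (`p = 2` included: `c = p^a`).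

What is NOT here: any construction of `𝐇¹`, `𝐇²`, `𝐇²_loc`, the Coleman map or the zeta elements
(they stay hypotheses); any identification of Kato's exceptional prime with `(T)` (a hypothesis `J`);
the integral clause 12.5 (4); Greenberg–Stevens (the VALUE of `L'(0)` plays no role in a
divisibility). The package of inputs that feeds these theorems at a multiplicative prime is typed
separately (`Kato2004/DivisibilityInputsMultiplicative.lean`).

## References

* K. Kato, Astérisque 295 (2004): Thm. 12.4 (p. 221), Thm. 12.5 (3) with (12.5.1) (p. 222), Remark
  12.7, §13.13 (pp. 233–234), 14.9 (p. 239), Thm. 16.6 (p. 271), Prop. 17.11, §17.13 (pp. 277–280),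
  Remark 18.3 / Thm. 18.4 (p. 281).
* C. Wuthrich, Doc. Math. 19 (2014) 381–402, p. 391 and Thm. 16 / Cor. 19 (p. 398).
* S. Kobayashi, Doc. Math. Extra Vol. Coates (2006) 567–575, Thm. 4.1.
* N. Bourbaki, *Algèbre commutative* II §2.4, VII §4.4–4.5 (lengths and localisation).
-/

noncomputable section

open scoped MatrixGroups ModularForm

open CongruenceSubgroup Literature.NumberTheory.EllipticCurves.ModularForms

namespace Literature.NumberTheory.EllipticCurves

namespace Kato2004

open Module

/-! ### Over an arbitrary domain -/

section Exceptional

variable {R : Type*} [CommRing R] [IsDomain R]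
  {H P X H2 H2loc : Type*} [AddCommGroup H] [_root_.Module R H] [AddCommGroup P]
  [_root_.Module R P] [AddCommGroup X] [_root_.Module R X] [AddCommGroup H2] [_root_.Module R H2]
  [AddCommGroup H2loc] [_root_.Module R H2loc]

omit [IsDomain R] in
/-- **The `𝐇²_loc`-term is carried by `𝐇²`.** For `X →δ H2 →ε H2loc` with `c · ε(δ x) = 0` for all
`x` (the pair is a complex up to `×c`, (17.13.1) at `𝐇²`) and `c · H2loc ⊆ ε(H2)` (the next
Poitou–Tate term is killed by `c`), at a prime `𝔭 ∌ c`: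
`length(δ X)_𝔭 + length(H2loc)_𝔭 ≤ length(H2)_𝔭` (`δ X ⊆ Ker ε` up to `c`, `H2/Ker ε ≅ ε(H2)` and
`H2loc/ε(H2)` dies at `𝔭`). [cite: Kato2004Asterisque, §17.13 (17.13.1) (p. 279) and 14.9 (p. 239)] -/
theorem lengthAt_range_add_le_of_upTo (δ : X →ₗ[R] H2) (ε : H2 →ₗ[R] H2loc) {c : R}
    (𝔭 : PrimeSpectrum R) (hc : c ∉ 𝔭.asIdeal) (hH2 : ∀ x : X, c • ε (δ x) = 0)
    (hcoker : ∀ y : H2loc, c • y ∈ LinearMap.range ε) :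
    lengthAt R (LinearMap.range δ) 𝔭 + lengthAt R H2loc 𝔭 ≤ lengthAt R H2 𝔭 := by
  -- `length (range δ) ≤ length (ker ε)` : `c • range δ ⊆ ker ε`
  have h1 : lengthAt R (LinearMap.range δ) 𝔭 ≤ lengthAt R (LinearMap.ker ε) 𝔭 := by
    refine lengthAt_le_of_smul_mem 𝔭 hc ?_
    rintro _ ⟨x, rfl⟩
    rw [LinearMap.mem_ker, map_smul]
    exact hH2 x
  -- `length H2loc = length (range ε)` : the cokernel is killed by `c`
  have h2 : lengthAt R H2loc 𝔭 = lengthAt R (LinearMap.range ε) 𝔭 := by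
    rw [lengthAt_eq_add_quotient (LinearMap.range ε) 𝔭,
      lengthAt_eq_zero_of_smul_eq_zero (M := H2loc ⧸ LinearMap.range ε) 𝔭 hc ?_, add_zero]
    intro m
    obtain ⟨y, rfl⟩ := (LinearMap.range ε).mkQ_surjective m
    rw [Submodule.mkQ_apply, ← Submodule.Quotient.mk_smul, Submodule.Quotient.mk_eq_zero]
    exact hcoker y
  -- `length H2 = length (ker ε) + length (range ε)`
  have h3 : lengthAt R H2 𝔭 =
      lengthAt R (LinearMap.ker ε) 𝔭 + lengthAt R (LinearMap.range ε) 𝔭 := by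
    rw [lengthAt_eq_add_quotient (LinearMap.ker ε) 𝔭,
      lengthAt_eq_of_linearEquiv ε.quotKerEquivRange 𝔭]
  rw [h3, h2]
  exact add_le_add h1 le_rfl

omit [IsDomain R] in
/-- **The bookkeeping of p. 280 with the Coleman map valued in an ideal `J`.** With `loc : H ↪ P`
and `col : P ↪ R` injective, `col(P) ⊆ J` and `G ∈ col(loc Z)`:
`length(P/loc H)_𝔭 + length(H/Z)_𝔭 + length(R/J)_𝔭 ≤ length(R/(G))_𝔭`
(`P/loc Z ≅ col P/col loc Z ⊆ J/col loc Z`, and `0 → J/col loc Z → R/col loc Z → R/J → 0`,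
`R/(G) ↠ R/col loc Z`). For `J = R` this is `lengthAt_quotient_range_add_le`. At a split
multiplicative prime `J = I` is the augmentation ideal (Kobayashi 2006 Thm. 4.1 via Wuthrich 2014
p. 391). [cite: Kato2004Asterisque, §17.13 (p. 280)] [cite: Wuthrich2014, p. 391 and Cor. 19 (p. 398)] -/
theorem lengthAt_quotient_range_add_le_of_range_le (loc : H →ₗ[R] P)
    (hinj : Function.Injective loc) (col : P →ₗ[R] R) (hcol : Function.Injective col)
    {J : Ideal R} (hJ : ∀ y : P, col y ∈ J) (Z : Submodule R H) {G : R}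
    (hGZ : G ∈ Submodule.map (col ∘ₗ loc) Z) (𝔭 : PrimeSpectrum R) :
    lengthAt R (P ⧸ LinearMap.range loc) 𝔭 + lengthAt R (H ⧸ Z) 𝔭 + lengthAt R (R ⧸ J) 𝔭 ≤
      lengthAt R (R ⧸ Ideal.span {G}) 𝔭 := by
  obtain ⟨z, hzZ, hz⟩ := Submodule.mem_map.mp hGZ
  simp only [LinearMap.coe_comp, Function.comp_apply] at hz
  set LZ : Submodule R P := Submodule.map loc Z with hLZ
  have hLZle : LZ ≤ LinearMap.range loc := LinearMap.map_le_range
  -- the image `N` of `range loc` in `P / LZ`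
  set N : Submodule R (P ⧸ LZ) := Submodule.map LZ.mkQ (LinearMap.range loc) with hN
  have hQN : lengthAt R (P ⧸ LZ) 𝔭 = lengthAt R N 𝔭 + lengthAt R ((P ⧸ LZ) ⧸ N) 𝔭 :=
    lengthAt_eq_add_quotient N 𝔭
  have hthird : lengthAt R ((P ⧸ LZ) ⧸ N) 𝔭 = lengthAt R (P ⧸ LinearMap.range loc) 𝔭 :=
    lengthAt_eq_of_linearEquiv (Submodule.quotientQuotientEquivQuotient LZ _ hLZle) 𝔭
  -- `N ≃ H / Z` (`loc` injective)
  have hNeq : lengthAt R N 𝔭 = lengthAt R (H ⧸ Z) 𝔭 := by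
    set g : H →ₗ[R] P ⧸ LZ := LZ.mkQ ∘ₗ loc with hg
    have hrange : LinearMap.range g = N := by
      rw [hg, LinearMap.range_comp, hN]
    have hker : LinearMap.ker g = Z := by
      rw [hg, LinearMap.ker_comp, Submodule.ker_mkQ, hLZ, Submodule.comap_map_eq_of_injective hinj]
    calc lengthAt R N 𝔭 = lengthAt R (LinearMap.range g) 𝔭 := by rw [hrange]
      _ = lengthAt R (H ⧸ LinearMap.ker g) 𝔭 :=
          (lengthAt_eq_of_linearEquiv g.quotKerEquivRange 𝔭).symm
      _ = lengthAt R (H ⧸ Z) 𝔭 := by rw [hker]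
  -- the ideal `I = col(loc Z) ⊆ J`, containing `G`
  set I : Ideal R := Submodule.map col LZ with hI
  have hGI : G ∈ I := ⟨loc z, ⟨z, hzZ, rfl⟩, hz⟩
  have hIJ : I ≤ J := by
    rintro _ ⟨y, -, rfl⟩
    exact hJ y
  -- the image `J'` of `J` in `R/I`
  set J' : Submodule R (R ⧸ I) := Submodule.map I.mkQ J with hJ'
  -- `P / LZ ↪ J'`
  have hQI : lengthAt R (P ⧸ LZ) 𝔭 ≤ lengthAt R J' 𝔭 := by
    set φ : (P ⧸ LZ) →ₗ[R] R ⧸ I := Submodule.mapQ LZ I col fun y hy => ⟨y, hy, rfl⟩ with hφ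
    have hφinj : Function.Injective φ := by
      rw [← LinearMap.ker_eq_bot, hφ, Submodule.ker_mapQ, Submodule.comap_map_eq_of_injective hcol,
        Submodule.mkQ_map_self]
    have hφmem : ∀ q : P ⧸ LZ, φ q ∈ J' := by
      intro q
      obtain ⟨y, rfl⟩ := LZ.mkQ_surjective q
      exact ⟨col y, hJ y, rfl⟩
    refine lengthAt_le_of_injective (LinearMap.codRestrict J' φ hφmem) ?_ 𝔭
    intro q₁ q₂ h
    exact hφinj (by simpa using congrArg Subtype.val h)
  -- `0 → J' → R/I → R/J → 0`
  have hsplit : lengthAt R (R ⧸ I) 𝔭 = lengthAt R J' 𝔭 + lengthAt R (R ⧸ J) 𝔭 := by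
    rw [lengthAt_eq_add_quotient J' 𝔭,
      lengthAt_eq_of_linearEquiv (Submodule.quotientQuotientEquivQuotient I J hIJ) 𝔭]
  -- `R/(G) ↠ R/I`
  have hIG : lengthAt R (R ⧸ I) 𝔭 ≤ lengthAt R (R ⧸ Ideal.span {G}) 𝔭 :=
    lengthAt_le_of_surjective (Submodule.factor ((Ideal.span_singleton_le_iff_mem I).mpr hGI))
      (Submodule.factor_surjective _) 𝔭
  calc lengthAt R (P ⧸ LinearMap.range loc) 𝔭 + lengthAt R (H ⧸ Z) 𝔭 + lengthAt R (R ⧸ J) 𝔭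
        = lengthAt R (P ⧸ LZ) 𝔭 + lengthAt R (R ⧸ J) 𝔭 := by rw [hQN, hthird, hNeq]; ring
    _ ≤ lengthAt R J' 𝔭 + lengthAt R (R ⧸ J) 𝔭 := add_le_add hQI le_rfl
    _ = lengthAt R (R ⧸ I) 𝔭 := hsplit.symm
    _ ≤ lengthAt R (R ⧸ Ideal.span {G}) 𝔭 := hIG

/-- **Kato's Thm. 17.4 (2)-shape at ONE prime, at an exceptional-zero prime (skeleton over a
domain).** Hypotheses: `H` torsion free of rank `≤ 1` (Thm. 12.4 (2)); the Poitou–Tate maps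
`H →loc P →toX X →δ H2 →ε H2loc` with `c · toX(loc H) = 0`, `c · Ker δ ⊆ toX(P)`,
`c · ε(δ X) = 0` and `c · H2loc ⊆ ε(H2)` ((17.13.1) "exact upto `×2`", 14.9 p. 239, with the next
term of the Poitou–Tate sequence `c`-torsion); an injective `col : P → R` with `col(P) ⊆ J`
(Kobayashi 2006 Thm. 4.1 / Wuthrich 2014 p. 391 shape: the Coleman map of the singular quotient at a
split multiplicative prime lands in the augmentation ideal); `Z ≤ H`, `G ≠ 0`, `G ∈ col(loc Z)`
(Thm. 16.6); at the prime `𝔭 ∌ c`: `length(H2loc)_𝔭 < ∞` and the PRINTED bound of Thm. 12.5 (3),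
`length(H2)_𝔭 ≤ length(H/Z)_𝔭 + length(H2loc)_𝔭`, error term INCLUDED. Conclusion:
`length X_𝔭 + length(R/J)_𝔭 ≤ length(R/(G))_𝔭`. The `H2loc`-terms cancel
(`lengthAt_range_add_le_of_upTo`); `J` enters through `lengthAt_quotient_range_add_le_of_range_le`.
[cite: Kato2004Asterisque, Thm. 12.5 (3) (p. 222), §17.13 (pp. 279–280), 14.9 (p. 239)] [cite: Wuthrich2014, p. 391, Thm. 16 and Cor. 19 (p. 398)] -/
theorem lengthAt_add_le_of_skeleton_exceptional [Module.IsTorsionFree R H]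
    (hrank : Module.rank R H ≤ 1) {c : R} (loc : H →ₗ[R] P) (toX : P →ₗ[R] X) (δ : X →ₗ[R] H2)
    (ε : H2 →ₗ[R] H2loc) (hPX : ∀ h : H, c • toX (loc h) = 0)
    (hXH : ∀ x : X, δ x = 0 → c • x ∈ LinearMap.range toX) (hH2 : ∀ x : X, c • ε (δ x) = 0)
    (hcoker : ∀ y : H2loc, c • y ∈ LinearMap.range ε) (col : P →ₗ[R] R)
    (hcol : Function.Injective col) {J : Ideal R} (hJ : ∀ y : P, col y ∈ J) (Z : Submodule R H)
    {G : R} (hG : G ≠ 0) (hGZ : G ∈ Submodule.map (col ∘ₗ loc) Z) (𝔭 : PrimeSpectrum R)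
    (hc : c ∉ 𝔭.asIdeal) (hfin : lengthAt R H2loc 𝔭 ≠ ⊤)
    (hES : lengthAt R H2 𝔭 ≤ lengthAt R (H ⧸ Z) 𝔭 + lengthAt R H2loc 𝔭) :
    lengthAt R X 𝔭 + lengthAt R (R ⧸ J) 𝔭 ≤ lengthAt R (R ⧸ Ideal.span {G}) 𝔭 := by
  obtain ⟨z, -, hz⟩ := Submodule.mem_map.mp hGZ
  simp only [LinearMap.coe_comp, Function.comp_apply] at hz
  have hinj : Function.Injective loc := loc_injective hrank loc col hG hz
  -- (1) `length X ≤ length (range toX) + length (range δ)`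
  have h1 : lengthAt R X 𝔭 ≤
      lengthAt R (LinearMap.range toX) 𝔭 + lengthAt R (LinearMap.range δ) 𝔭 := by
    refine lengthAt_le_add_of_smul_ker_le δ.rangeRestrict (LinearMap.range toX) 𝔭 hc
      fun x hx => hXH x ?_
    simpa using congrArg Subtype.val hx
  -- (2) `length (range δ) ≤ length (H/Z)` : the `H2loc`-terms cancel
  have h2 : lengthAt R (LinearMap.range δ) 𝔭 ≤ lengthAt R (H ⧸ Z) 𝔭 := by
    have h := (lengthAt_range_add_le_of_upTo δ ε 𝔭 hc hH2 hcoker).trans hES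
    exact (WithTop.add_le_add_iff_right hfin).mp h
  -- (3) `length (range toX) ≤ length (P / range loc)`
  have h3 : lengthAt R (LinearMap.range toX) 𝔭 ≤ lengthAt R (P ⧸ LinearMap.range loc) 𝔭 := by
    rw [← lengthAt_eq_of_linearEquiv toX.quotKerEquivRange 𝔭]
    refine lengthAt_quotient_le_of_smul_mem 𝔭 hc ?_
    rintro _ ⟨h, rfl⟩
    rw [LinearMap.mem_ker, map_smul]
    exact hPX h
  calc lengthAt R X 𝔭 + lengthAt R (R ⧸ J) 𝔭
      ≤ lengthAt R (P ⧸ LinearMap.range loc) 𝔭 + lengthAt R (H ⧸ Z) 𝔭 +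
          lengthAt R (R ⧸ J) 𝔭 := add_le_add (h1.trans (add_le_add h3 h2)) le_rfl
    _ ≤ lengthAt R (R ⧸ Ideal.span {G}) 𝔭 :=
        lengthAt_quotient_range_add_le_of_range_le loc hinj col hcol hJ Z hGZ 𝔭

end Exceptional

/-! ### Over `Λ = ℤ_p⟦T⟧`: `T · char_Λ X ∣ p^m · L` -/

section Iwasawa

variable (p : ℕ) [Fact p.Prime]
  {H P X H2 H2loc : Type*} [AddCommGroup H] [_root_.Module (IwasawaAlgebra p) H]
  [AddCommGroup P] [_root_.Module (IwasawaAlgebra p) P]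
  [AddCommGroup X] [_root_.Module (IwasawaAlgebra p) X]
  [AddCommGroup H2] [_root_.Module (IwasawaAlgebra p) H2]
  [AddCommGroup H2loc] [_root_.Module (IwasawaAlgebra p) H2loc]

/-- An element `G` of `Λ = ℤ_p⟦T⟧` whose image in `ℚ_p⟦T⟧` is `p^n · L` with `L(0) = 0` is
divisible by `T`: `G = T · G₁`. [folklore] -/
private theorem exists_eq_X_mul_of_constantCoeff_eq_zero {G : IwasawaAlgebra p} {L : PowerSeries ℚ_[p]}
    {n : ℕ} (hιG : iwasawaToPowerSeries p G = PowerSeries.C ((p : ℚ_[p]) ^ n) * L)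
    (hL0 : PowerSeries.constantCoeff L = 0) :
    ∃ G₁ : IwasawaAlgebra p, G = PowerSeries.X * G₁ := by
  have h0 : PowerSeries.constantCoeff (iwasawaToPowerSeries p G) = 0 := by
    rw [hιG, map_mul, PowerSeries.constantCoeff_C, hL0, mul_zero]
  have hG0 : PowerSeries.constantCoeff G = 0 := by
    rw [← PowerSeries.coeff_zero_eq_constantCoeff_apply, PowerSeries.coeff_map,
      PowerSeries.coeff_zero_eq_constantCoeff_apply, map_eq_zero_iff _
        (IsFractionRing.injective ℤ_[p] ℚ_[p])] at h0
    exact h0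
  exact PowerSeries.X_dvd_iff.mpr hG0

/-- **Kato's Thm. 17.4 (1)(2)-shape at an EXCEPTIONAL-ZERO prime for `Λ = ℤ_p⟦T⟧`, in the tree's
form `T · char_Λ X ∣ p^m · L`.** Hypotheses as in `exists_mem_charIdeal_of_skeleton_upTo` (file
`KatoRankBoundAllPrimesSkeletonProofs`: `H` torsion free of rank `≤ 1`, the maps `H → P → X → H2`
exact up to `×c` with `c ≠ 0` in no height-one `𝔭 ∌ p`, `col : P ↪ Λ`, `H2` torsion, `Z ≤ H`,
`G ≠ 0`, `G ∈ col(loc Z)`, `ι G = p^n · L`, the Euler-system bound of Thm. 12.5 (3) at the height-one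
`𝔭 ∌ p` IN ITS PRINTED SHAPE with the `H2loc`-term), EXCEPT that the `H2loc`-term is NOT assumed to
vanish; instead: `ε : H2 → H2loc` with `c · ε(δ X) = 0` and `c · H2loc ⊆ ε(H2)` (the five-term
(17.13.1) and the next Poitou–Tate term), `H2loc` of finite length at those `𝔭`, the Coleman map
valued in the augmentation ideal, `col(P) ⊆ (T)` (Kobayashi 2006 Thm. 4.1 shape), and `L(0) = 0`
(the exceptional zero, Mazur–Tate–Teitelbaum §I.15). Conclusion: `X` is `Λ`-torsion and
`ι(T · g) = p^m · L` for some `m` and some `g ∈ char_Λ X`. Proof: at every height-one `𝔭 ∌ p`,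
`length X_𝔭 + length(Λ/(T))_𝔭 ≤ length(Λ/(G))_𝔭` (`lengthAt_add_le_of_skeleton_exceptional`);
`G = T · G₁` (`L(0) = 0`), `length(Λ/(G))_𝔭 = length(Λ/(T))_𝔭 + length(Λ/(G₁))_𝔭`, so
`length X_𝔭 ≤ length(Λ/(G₁))_𝔭`, and the bridge `Module.exists_pow_mul_mem_charIdeal_of_lengthAt_le`
gives `p^m G₁ ∈ char_Λ X`. [cite: Kato2004Asterisque, Thm. 12.5 (3) (p. 222), Thm. 17.4 (1)(2) (p. 273), §17.13 (pp. 279–280), 14.9 (p. 239)]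
[cite: Wuthrich2014, Cor. 19 (p. 398) (I · char X ∣ (L_p), odd p; shape)] -/
theorem exists_X_mul_mem_charIdeal_of_skeleton_exceptional [Module.Finite (IwasawaAlgebra p) X]
    [Module.IsTorsionFree (IwasawaAlgebra p) H] (hrank : Module.rank (IwasawaAlgebra p) H ≤ 1)
    {c : IwasawaAlgebra p} (hc0 : c ≠ 0)
    (hc : ∀ 𝔭 : PrimeSpectrum (IwasawaAlgebra p), 𝔭.asIdeal.height = 1 →
      PowerSeries.C (p : ℤ_[p]) ∉ 𝔭.asIdeal → c ∉ 𝔭.asIdeal)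
    (loc : H →ₗ[IwasawaAlgebra p] P) (toX : P →ₗ[IwasawaAlgebra p] X)
    (δ : X →ₗ[IwasawaAlgebra p] H2) (ε : H2 →ₗ[IwasawaAlgebra p] H2loc)
    (hPX : ∀ h : H, c • toX (loc h) = 0)
    (hXH : ∀ x : X, δ x = 0 → c • x ∈ LinearMap.range toX)
    (hH2 : ∀ x : X, c • ε (δ x) = 0) (hcoker : ∀ y : H2loc, c • y ∈ LinearMap.range ε)
    (col : P →ₗ[IwasawaAlgebra p] IwasawaAlgebra p) (hcol : Function.Injective col)
    (hJ : ∀ y : P, col y ∈ Ideal.span {(PowerSeries.X : IwasawaAlgebra p)})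
    (hH2t : Module.IsTorsion (IwasawaAlgebra p) H2)
    (Z : Submodule (IwasawaAlgebra p) H) {G : IwasawaAlgebra p} (hG : G ≠ 0)
    (hGZ : G ∈ Submodule.map (col ∘ₗ loc) Z)
    (hfin : ∀ 𝔭 : PrimeSpectrum (IwasawaAlgebra p), 𝔭.asIdeal.height = 1 →
      PowerSeries.C (p : ℤ_[p]) ∉ 𝔭.asIdeal → lengthAt (IwasawaAlgebra p) H2loc 𝔭 ≠ ⊤)
    (hES : ∀ 𝔭 : PrimeSpectrum (IwasawaAlgebra p), 𝔭.asIdeal.height = 1 →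
      PowerSeries.C (p : ℤ_[p]) ∉ 𝔭.asIdeal →
        lengthAt (IwasawaAlgebra p) H2 𝔭 ≤
          lengthAt (IwasawaAlgebra p) (H ⧸ Z) 𝔭 + lengthAt (IwasawaAlgebra p) H2loc 𝔭)
    {L : PowerSeries ℚ_[p]} {n : ℕ}
    (hιG : iwasawaToPowerSeries p G = PowerSeries.C ((p : ℚ_[p]) ^ n) * L)
    (hL0 : PowerSeries.constantCoeff L = 0) :
    Module.IsTorsion (IwasawaAlgebra p) X ∧
      ∃ (m : ℕ) (g : IwasawaAlgebra p), g ∈ charIdeal (IwasawaAlgebra p) X ∧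
        iwasawaToPowerSeries p (PowerSeries.X * g) = PowerSeries.C ((p : ℚ_[p]) ^ m) * L := by
  obtain ⟨z, -, hz⟩ := Submodule.mem_map.mp hGZ
  simp only [LinearMap.coe_comp, Function.comp_apply] at hz
  have htors : Module.IsTorsion (IwasawaAlgebra p) X :=
    isTorsion_of_skeleton_upTo hc0 loc toX δ hPX hXH col hcol hG hz hH2t
  refine ⟨htors, ?_⟩
  -- `G = T · G₁`
  obtain ⟨G₁, hG₁⟩ := exists_eq_X_mul_of_constantCoeff_eq_zero p hιG hL0
  have hG₁0 : G₁ ≠ 0 := by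
    rintro rfl
    exact hG (by rw [hG₁, mul_zero])
  have hX0 : (PowerSeries.X : IwasawaAlgebra p) ≠ 0 := PowerSeries.X_ne_zero
  -- the length inequality `length X_𝔭 ≤ length (Λ/(G₁))_𝔭` at the height-one `𝔭 ∌ p`
  have hlen : ∀ 𝔭 : PrimeSpectrum (IwasawaAlgebra p), 𝔭.asIdeal.height = 1 →
      PowerSeries.C (p : ℤ_[p]) ∉ 𝔭.asIdeal →
        lengthAt (IwasawaAlgebra p) X 𝔭 ≤
          lengthAt (IwasawaAlgebra p) (IwasawaAlgebra p ⧸ Ideal.span {G₁}) 𝔭 := by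
    intro 𝔭 h1 hp𝔭
    have h := lengthAt_add_le_of_skeleton_exceptional hrank loc toX δ ε hPX hXH hH2 hcoker col hcol
      hJ Z hG hGZ 𝔭 (hc 𝔭 h1 hp𝔭) (hfin 𝔭 h1 hp𝔭) (hES 𝔭 h1 hp𝔭)
    rw [hG₁, lengthAt_quotient_span_singleton_mul G₁ hX0 𝔭] at h
    -- cancel the finite term `length (Λ/(T))_𝔭`
    have hTfin : lengthAt (IwasawaAlgebra p)
        (IwasawaAlgebra p ⧸ Ideal.span {(PowerSeries.X : IwasawaAlgebra p)}) 𝔭 ≠ ⊤ := by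
      rw [lengthAt_quotient_span_singleton PowerSeries.X_prime 𝔭 h1]
      split_ifs <;> simp
    rw [add_comm (lengthAt (IwasawaAlgebra p) (IwasawaAlgebra p ⧸ Ideal.span {PowerSeries.X}) 𝔭)]
      at h
    exact (WithTop.add_le_add_iff_right hTfin).mp h
  obtain ⟨m, hm⟩ :=
    exists_pow_mul_mem_charIdeal_of_lengthAt_le htors (IwasawaAlgebra.prime_C p) hG₁0 hlen
  refine ⟨m + n, PowerSeries.C (p : ℤ_[p]) ^ m * G₁, hm, ?_⟩
  calc iwasawaToPowerSeries p (PowerSeries.X * (PowerSeries.C (p : ℤ_[p]) ^ m * G₁))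
      = iwasawaToPowerSeries p (PowerSeries.C (p : ℤ_[p]) ^ m * G) := by
        rw [hG₁]; ring_nf
    _ = PowerSeries.C ((p : ℚ_[p]) ^ (m + n)) * L := by
        rw [map_mul, map_pow, hιG, PowerSeries.map_C, map_natCast, ← mul_assoc, ← map_pow,
          ← map_mul, ← pow_add]

end Iwasawa

end Kato2004

end Literature.NumberTheory.EllipticCurves

end
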